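import Summits.CriticalPhenomena.PercolationContinuityZ3.Theorems.Transplant.FKThreeApexT5Final
import Summits.CriticalPhenomena.PercolationContinuityZ3.Theorems.Transplant.FKThreeApexNegCorrTri
import HarnessLib

/-!
# `K_{1,1,1,n}`: a leaf edge and the OPPOSITE triangle edge are negatively correlated (type T5), `0 < q ≤ 1`

Support file (`--supports stmt-CriticalPhenomena-4575`), FK sub-lane `prim-bschramm-fk-3` (gen 14); builds on p205010 (kernel theorem, internal audit
signed; external expert review pending).  No named facts, no sorries; standard axioms.  Memo `bschramm/prim-bschramm-fk-3/DISJOINT-VIA-U.md`.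

Setting of `…ThreeApexNegCorrTri` (weighted `K_{1,1,1,n}`: apices `a,b,c`, leaves `v j`, arbitrary parameters `w`, `0 < q ≤ 1`).  The first of the two
DISJOINT pair types left open there: **`negCorrTri_leaf_opp`** — the leaf edge `s(x, v j₀)` and the triangle edge avoiding `x` satisfy
`φ(J_e ∩ J_f) ≤ φ(J_e) φ(J_f)`; core case `negCorrTri_leaf_bc` (`x = a`, `f = bc`) from the monoid inequality `InK.rayleigh_T5_nonneg` (the semigroup
theorem for `Ω_q`, files `…OmegaClosure1/2`, `…T5Final`) by the transfer formula and the pinning tools, the other apices by relabelling.  With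
`negCorrTri_leaf_edge` (T4): a leaf edge and ANY triangle edge are negatively correlated (`negCorrTri_leaf_triangle`).  The only pair type of
`K_{1,1,1,n}` not covered by this file and `negCorr_adjacent_tri` is T3 (`s(x, v j₁)`, `s(y, v j₂)` with `x ≠ y`, `j₁ ≠ j₂`).
[cite: Grimmett2006, §3.9 eq. (3.94), Conj. (3.96) (pp. 63–66)] [cite: Wagner2006, Conj. 5.3 (p. 13)]
-/

noncomputable section

namespace Summit.CriticalPhenomena.PercolationContinuityZ3.Theorems

namespace FK

namespace ThreeApex

open Literature.Probability.LatticeModels Literature.Probability.Percolation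
open scoped Classical

variable {V : Type*} [Fintype V]

section Setting

variable {a b c : V} {v : ℕ → V} {n : ℕ}
variable (hab : a ≠ b) (hac : a ≠ c) (hbc : b ≠ c) (hinj : ∀ j k, j < n → k < n → v j = v k → j = k)
  (hva : ∀ j, j < n → v j ≠ a) (hvb : ∀ j, j < n → v j ≠ b) (hvc : ∀ j, j < n → v j ≠ c)
include hab hac hbc hinj hva hvb hvc

omit [Fintype V] hinj in
/-- Re-pinning the `a`-edge of a leaf and the triangle edge `bc`: the triangle letters become `edgeAB · edgeAC · edgeBC τ`. [folklore] -/
theorem triLetter_pin_leaf_bc (w : Sym2 V → unitInterval) {j₀ : ℕ} (hj₀ : j₀ < n) (σ τ : unitInterval) :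
    triLetter (Function.update (Function.update w s(a, v j₀) σ) s(b, c) τ) a b c =
      edgeAB ((w s(a, b) : unitInterval) : ℝ) * (edgeAC ((w s(a, c) : unitInterval) : ℝ) * edgeBC (τ : ℝ)) := by
  obtain ⟨-, n13, n23⟩ := triPairs_ne hab hac hbc (V := V)
  obtain ⟨m1, m2, -⟩ := apexPair_ne_tri hva hvb hvc a hj₀
  simp only [triLetter, Function.update_self, Function.update_of_ne n13, Function.update_of_ne n23,
    Function.update_of_ne m1.symm, Function.update_of_ne m2.symm]

/-- **T5 in `K_{1,1,1,n}`** (core case): the leaf edge `s(a, v j₀)` and the opposite triangle edge `s(b, c)` are negatively correlated.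
(transcription of bschramm/prim-bschramm-fk-3/DISJOINT-VIA-U.md §0) -/
theorem negCorrTri_leaf_bc {q : ℝ} (hq0 : 0 < q) (hq1 : q ≤ 1) (hcard : Fintype.card V = n + 3) (w : Sym2 V → unitInterval)
    (hsupp : ∀ e, e ∉ fullPairs a b c v n → w e = 0) {j₀ : ℕ} (hj₀ : j₀ < n) :
    (rcMeasureW w q ∅).real ({ω : BondConfig V | s(a, v j₀) ∈ ω} ∩ {ω | s(b, c) ∈ ω}) ≤
      (rcMeasureW w q ∅).real {ω : BondConfig V | s(a, v j₀) ∈ ω} * (rcMeasureW w q ∅).real {ω : BondConfig V | s(b, c) ∈ ω} := by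
  obtain ⟨-, -, m3⟩ := apexPair_ne_tri hva hvb hvc (v := v) a hj₀
  have he : s(a, v j₀) ∈ fullPairs a b c v n := mem_fullPairs_of (Or.inl ((mem_apexPairs_iff _).2 ⟨j₀, hj₀, Or.inl rfl⟩))
  have hbc' : s(b, c) ∈ triPairs a b c := (mem_triPairs_iff a b c _).2 (Or.inr (Or.inr rfl))
  have hf : s(b, c) ∈ fullPairs a b c v n := mem_fullPairs_of (Or.inr hbc')
  set R := (edgeAB ((w s(a, b) : unitInterval) : ℝ) * edgeAC ((w s(a, c) : unitInterval) : ℝ)) *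
    ∏ j ∈ (Finset.range n).erase j₀, leafOf q w a b c (v j) with hR
  have hRK : InK q R :=
    ((IsLetter.ab (q := q) (w s(a, b)).2.1 (w s(a, b)).2.2).inK.mul (IsLetter.ac (q := q) (w s(a, c)).2.1 (w s(a, c)).2.2).inK).mul
      (inK_prod _ _ fun j _ => isLetter_leafOf q w a b c (v j))
  have hZ : ∀ σ τ : unitInterval, rcPartitionFunctionW (Function.update (Function.update w s(a, v j₀) σ) s(b, c) τ) q ∅ =
      val q (leaf q (σ : ℝ) ((w s(b, v j₀) : unitInterval) : ℝ) ((w s(c, v j₀) : unitInterval) : ℝ) * (edgeBC (τ : ℝ) * R)) := by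
    intro σ τ
    rw [rcPartitionFunctionW_eq_transfer3T hab hac hbc hinj hva hvb hvc hcard q _
      (supp_update_fullPair _ (supp_update_fullPair w hsupp he σ) hf τ), transfer3T,
      triLetter_pin_leaf_bc hab hac hbc hva hvb hvc (v := v) w hj₀ σ τ, zvec_pin_leaf_tri hab hac hbc hinj hva hvb hvc q w hbc' hj₀ σ τ, hR]
    congr 1
    ac_rfl
  refine negCorr_of_pinned_rayleigh w hq0 m3.symm ?_
  rw [hZ, hZ, hZ, hZ, Set.Icc.coe_one, Set.Icc.coe_zero]
  have h := InK.rayleigh_T5_nonneg hq0.le hq1 (w s(b, v j₀)).2.1 (w s(b, v j₀)).2.2 (w s(c, v j₀)).2.1 (w s(c, v j₀)).2.2 hRK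
  simp only [← mul_def] at h
  linarith

/-- **T5 in `K_{1,1,1,n}`**: a leaf edge `s(x, v j₀)` and the triangle edge `f` avoiding `x` are negatively correlated.
(transcription of bschramm/prim-bschramm-fk-3/DISJOINT-VIA-U.md §0) -/
theorem negCorrTri_leaf_opp {q : ℝ} (hq0 : 0 < q) (hq1 : q ≤ 1) (hcard : Fintype.card V = n + 3) (w : Sym2 V → unitInterval)
    (hsupp : ∀ e, e ∉ fullPairs a b c v n → w e = 0) {j₀ : ℕ} (hj₀ : j₀ < n) {x : V} (hx : x = a ∨ x = b ∨ x = c) {f : Sym2 V}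
    (hf : f ∈ triPairs a b c) (hxf : x ∉ f) :
    (rcMeasureW w q ∅).real ({ω : BondConfig V | s(x, v j₀) ∈ ω} ∩ {ω | f ∈ ω}) ≤
      (rcMeasureW w q ∅).real {ω : BondConfig V | s(x, v j₀) ∈ ω} * (rcMeasureW w q ∅).real {ω : BondConfig V | f ∈ ω} := by
  have hA : (rcMeasureW w q ∅).real ({ω : BondConfig V | s(a, v j₀) ∈ ω} ∩ {ω | s(b, c) ∈ ω}) ≤
      (rcMeasureW w q ∅).real {ω : BondConfig V | s(a, v j₀) ∈ ω} * (rcMeasureW w q ∅).real {ω : BondConfig V | s(b, c) ∈ ω} :=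
    negCorrTri_leaf_bc hab hac hbc hinj hva hvb hvc hq0 hq1 hcard w hsupp hj₀
  have hB : (rcMeasureW w q ∅).real ({ω : BondConfig V | s(b, v j₀) ∈ ω} ∩ {ω | s(a, c) ∈ ω}) ≤
      (rcMeasureW w q ∅).real {ω : BondConfig V | s(b, v j₀) ∈ ω} * (rcMeasureW w q ∅).real {ω : BondConfig V | s(a, c) ∈ ω} := by
    have h := negCorrTri_leaf_bc hbc hab.symm hac.symm hinj hvb hvc hva hq0 hq1 hcard w (by rw [fullPairs_rotate]; exact hsupp) hj₀
    rwa [Sym2.eq_swap (a := c) (b := a)] at h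
  have hC : (rcMeasureW w q ∅).real ({ω : BondConfig V | s(c, v j₀) ∈ ω} ∩ {ω | s(a, b) ∈ ω}) ≤
      (rcMeasureW w q ∅).real {ω : BondConfig V | s(c, v j₀) ∈ ω} * (rcMeasureW w q ∅).real {ω : BondConfig V | s(a, b) ∈ ω} :=
    negCorrTri_leaf_bc hac.symm hbc.symm hab hinj hvc hva hvb hq0 hq1 hcard w
      (by rw [fullPairs_rotate, fullPairs_rotate]; exact hsupp) hj₀
  rcases (mem_triPairs_iff a b c f).1 hf with rfl | rfl | rfl <;> rcases hx with rfl | rfl | rfl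
  · exact absurd (Sym2.mem_mk_left _ _) hxf
  · exact absurd (Sym2.mem_mk_right _ _) hxf
  · exact hC
  · exact absurd (Sym2.mem_mk_left _ _) hxf
  · exact hB
  · exact absurd (Sym2.mem_mk_right _ _) hxf
  · exact hA
  · exact absurd (Sym2.mem_mk_left _ _) hxf
  · exact absurd (Sym2.mem_mk_right _ _) hxf

/-- **A leaf edge and any triangle edge of `K_{1,1,1,n}` are negatively correlated** (T4 of `…NegCorrTri` and T5 above), `0 < q ≤ 1`.
(transcription of bschramm/prim-bschramm-fk-3/DISJOINT-VIA-U.md §0) -/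
theorem negCorrTri_leaf_triangle {q : ℝ} (hq0 : 0 < q) (hq1 : q ≤ 1) (hcard : Fintype.card V = n + 3) (w : Sym2 V → unitInterval)
    (hsupp : ∀ e, e ∉ fullPairs a b c v n → w e = 0) {j₀ : ℕ} (hj₀ : j₀ < n) {x : V} (hx : x = a ∨ x = b ∨ x = c) {f : Sym2 V}
    (hf : f ∈ triPairs a b c) :
    (rcMeasureW w q ∅).real ({ω : BondConfig V | s(x, v j₀) ∈ ω} ∩ {ω | f ∈ ω}) ≤
      (rcMeasureW w q ∅).real {ω : BondConfig V | s(x, v j₀) ∈ ω} * (rcMeasureW w q ∅).real {ω : BondConfig V | f ∈ ω} := by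
  by_cases hxf : x ∈ f
  · exact negCorrTri_leaf_edge hab hac hbc hinj hva hvb hvc hq0 hq1 hcard w hsupp hj₀ hx hf hxf
  · exact negCorrTri_leaf_opp hab hac hbc hinj hva hvb hvc hq0 hq1 hcard w hsupp hj₀ hx hf hxf

/-- **A triangle edge of `K_{1,1,1,n}` is negatively correlated with EVERY other pair** (`0 < q ≤ 1`): with `negCorrTri_edges` (T6) and
`negCorrTri_leaf_triangle` (T4, T5).  Hence the only pair type of the weighted `K_{1,1,1,n}` not yet covered is T3 (two apex–leaf pairs with
distinct apices and distinct leaves). (transcription of bschramm/prim-bschramm-fk-3/DISJOINT-VIA-U.md §0) -/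
theorem negCorrTri_triangle_any {q : ℝ} (hq0 : 0 < q) (hq1 : q ≤ 1) (hcard : Fintype.card V = n + 3) (w : Sym2 V → unitInterval)
    (hsupp : ∀ e, e ∉ fullPairs a b c v n → w e = 0) {e f : Sym2 V} (he : e ∈ fullPairs a b c v n) (hf : f ∈ triPairs a b c) (hfe : f ≠ e) :
    (rcMeasureW w q ∅).real ({ω : BondConfig V | e ∈ ω} ∩ {ω | f ∈ ω}) ≤
      (rcMeasureW w q ∅).real {ω : BondConfig V | e ∈ ω} * (rcMeasureW w q ∅).real {ω : BondConfig V | f ∈ ω} := by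
  rcases (mem_fullPairs_iff a b c v n e).1 he with he' | he'
  · obtain ⟨j, hj, hx⟩ := (mem_apexPairs_iff (a := a) (b := b) (c := c) (v := v) (n := n) e).1 he'
    rcases hx with rfl | rfl | rfl
    · exact negCorrTri_leaf_triangle hab hac hbc hinj hva hvb hvc hq0 hq1 hcard w hsupp hj (Or.inl rfl) hf
    · exact negCorrTri_leaf_triangle hab hac hbc hinj hva hvb hvc hq0 hq1 hcard w hsupp hj (Or.inr (Or.inl rfl)) hf
    · exact negCorrTri_leaf_triangle hab hac hbc hinj hva hvb hvc hq0 hq1 hcard w hsupp hj (Or.inr (Or.inr rfl)) hf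
  · exact negCorrTri_edges hab hac hbc hinj hva hvb hvc hq0 hq1 hcard w hsupp he' hf hfe

end Setting

end ThreeApex

end FK

end Summit.CriticalPhenomena.PercolationContinuityZ3.Theorems
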